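import Mathlib
import HarnessLib
import Summits.NavierStokesRegularity.NavierStokesRegularity.Theorems.AxisTwistDoorSignConeDefs
import Summits.NavierStokesRegularity.NavierStokesRegularity.Theorems.AxisTwistDoorSignConeToolkit

/-!
# AxisTwistDoor · crux `TiltDominationLoc` (stmt-NavierStokesRegularity-26991) · line «signcone» — WEDGE BOOKKEEPING II:
# PLANARITY OF A SIGN CONE WITH EMPTY INTERIOR (helper H2 named by the LEAD)

Helper file (`--supports stmt-NavierStokesRegularity-26991 --as helper`; seat ns-imp-p1 g5, DIRECTOR-NS #250 (1); name H2 chosen by the LEAD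
ns-atd-p1 g4, 2026-08-28T17:12Z; line author ns-idea-6 g7).  No definitions; pure convex geometry in `E3 = EuclideanSpace ℝ (Fin 3)`.

* `interior_nonempty_of_convex_of_linearIndependent` — a CONVEX set of `E3` containing `0` and three linearly independent vectors has
  non-empty interior (its affine span is everything: `Convex.interior_nonempty_iff_affineSpan_eq_top`,
  `LinearIndependent.span_eq_top_of_card_eq_finrank`);
* `linearIndependent_of_not_mem_span_pair` — `e₃ ≠ 0`, `e ∉ ℝe₃`, `f ∉ span{e₃, e}` ⇒ `![f, e, e₃]` is linearly independent;
* `signCone_subset_span_of_interior_empty` (H2) — for any profile `w`: if `e₃, e ∈ SignCone w`, `e ∉ ℝ e₃` and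
  `interior (SignCone w) = ∅`, then `SignCone w ⊆ span{e₃, e}` — the sign cone of the planar-wedge rung
  `stub_planarWedgeRigidity` is a closed convex cone INSIDE THE PLANE of its two independent one-signed directions.

HONEST FRAMING: kinematic bookkeeping on HYPOTHETICAL one-signed Type-I profiles; nothing here proves the planar-wedge rung, the wall
`stub_rayRigidity`, crux 26991, the leaf or any NS regularity statement (Clay A OPEN).
-/

noncomputable section

-- the summit and its single sub-problem share the name (CONVENTIONS §1), as in every Theorems file
set_option linter.dupNamespace false

namespace Summit.NavierStokesRegularity.NavierStokesRegularity.Theorems.AxisTwistDoorSignConePlanarity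

open Set Function
open scoped InnerProductSpace RealInnerProductSpace
open Literature.Analysis Literature.Analysis.FluidPDE
open Summit.NavierStokesRegularity.NavierStokesRegularity.Theorems.AxisTwistDoorSignConeDefs
open Summit.NavierStokesRegularity.NavierStokesRegularity.Theorems.AxisTwistDoorSignConeToolkit
  (convex_signCone zero_mem_signCone)

/-! ### §1 Convex geometry in `ℝ³` -/

/-- **A convex set of `ℝ³` containing `0` and three linearly independent vectors has non-empty interior.** [folklore] -/
theorem interior_nonempty_of_convex_of_linearIndependent {K : Set (EuclideanSpace ℝ (Fin 3))} (hK : Convex ℝ K)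
    (h0 : (0 : EuclideanSpace ℝ (Fin 3)) ∈ K) {k : Fin 3 → EuclideanSpace ℝ (Fin 3)} (hk : LinearIndependent ℝ k)
    (hmem : ∀ i, k i ∈ K) : (interior K).Nonempty := by
  rw [hK.interior_nonempty_iff_affineSpan_eq_top, AffineSubspace.affineSpan_eq_top_iff_vectorSpan_eq_top_of_nonempty ℝ _ _ ⟨0, h0⟩,
    vectorSpan_eq_span_vsub_set_right ℝ h0]
  have himg : ((· -ᵥ (0 : EuclideanSpace ℝ (Fin 3))) '' K) = K := by
    simp [vsub_eq_sub]
  rw [himg, eq_top_iff, ← hk.span_eq_top_of_card_eq_finrank (by simp)]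
  exact Submodule.span_mono (range_subset_iff.2 hmem)

/-- `e₃ ≠ 0`, `e ∉ ℝ e₃` and `f ∉ span{e₃, e}` make `![f, e, e₃]` linearly independent. [folklore] -/
theorem linearIndependent_of_not_mem_span_pair {e₀ e f : EuclideanSpace ℝ (Fin 3)} (he₀ : e₀ ≠ 0)
    (hind : ∀ c : ℝ, e ≠ c • e₀) (hf : f ∉ Submodule.span ℝ ({e₀, e} : Set (EuclideanSpace ℝ (Fin 3)))) :
    LinearIndependent ℝ ![f, e, e₀] := by
  rw [linearIndependent_finSucc]
  refine ⟨?_, ?_⟩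
  · -- `![e, e₀]`
    have htail : Fin.tail ![f, e, e₀] = ![e, e₀] := by
      funext i; fin_cases i <;> rfl
    rw [htail, linearIndependent_fin2]
    refine ⟨?_, fun a ha => hind a ?_⟩
    · simpa using he₀
    · simpa using ha.symm
  · -- `f ∉ span {e, e₀}`
    have htail : Fin.tail ![f, e, e₀] = ![e, e₀] := by
      funext i; fin_cases i <;> rfl
    have h0 : (![f, e, e₀] : Fin 3 → EuclideanSpace ℝ (Fin 3)) 0 = f := rfl
    rw [htail, h0]
    intro hmem
    refine hf (Submodule.span_mono ?_ hmem)
    rintro _ ⟨i, rfl⟩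
    fin_cases i <;> simp

/-! ### §2 (H2) The sign cone of the planar-wedge rung lies in a plane -/

/-- **(H2) PLANARITY.**  If `e₃` and `e` are one-signed directions of `w` with `e ∉ ℝe₃`, and the sign cone `SignCone w` has empty
interior, then `SignCone w ⊆ span{e₃, e}`: otherwise the cone (convex, containing `0`) would contain three linearly independent
vectors and hence an interior point. [folklore] -/
theorem signCone_subset_span_of_interior_empty {w : ℝ → EuclideanSpace ℝ (Fin 3) → EuclideanSpace ℝ (Fin 3)}
    {e : EuclideanSpace ℝ (Fin 3)} (he₃ : EuclideanSpace.single (2 : Fin 3) (1 : ℝ) ∈ SignCone w) (he : e ∈ SignCone w)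
    (hind : ∀ c : ℝ, e ≠ c • EuclideanSpace.single (2 : Fin 3) (1 : ℝ)) (hint : interior (SignCone w) = ∅) :
    SignCone w ⊆ (Submodule.span ℝ ({EuclideanSpace.single (2 : Fin 3) (1 : ℝ), e} : Set (EuclideanSpace ℝ (Fin 3))) :
      Set (EuclideanSpace ℝ (Fin 3))) := by
  intro f hf
  by_contra hfs
  -- the sign cone is convex and contains `0` (LEAD's toolkit)
  have hconv : Convex ℝ (SignCone w) := convex_signCone
  have h0 : (0 : EuclideanSpace ℝ (Fin 3)) ∈ SignCone w := zero_mem_signCone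
  have he₃0 : EuclideanSpace.single (2 : Fin 3) (1 : ℝ) ≠ 0 := by
    intro h
    have := congrArg (fun z : EuclideanSpace ℝ (Fin 3) => z 2) h
    simp at this
  have hli := linearIndependent_of_not_mem_span_pair he₃0 hind hfs
  have hne := interior_nonempty_of_convex_of_linearIndependent hconv h0 hli fun i => by
    fin_cases i
    · exact hf
    · exact he
    · exact he₃
  rw [hint] at hne
  exact Set.not_nonempty_empty hne

/-- (H2) with the `IsCore`-free hypotheses packaged as in `stub_planarWedgeRigidity`: every one-signed direction of such a profile is a
combination `a • e₃ + b • e`. [folklore] -/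
theorem exists_eq_add_smul_of_mem_signCone {w : ℝ → EuclideanSpace ℝ (Fin 3) → EuclideanSpace ℝ (Fin 3)}
    {e : EuclideanSpace ℝ (Fin 3)} (he₃ : EuclideanSpace.single (2 : Fin 3) (1 : ℝ) ∈ SignCone w) (he : e ∈ SignCone w)
    (hind : ∀ c : ℝ, e ≠ c • EuclideanSpace.single (2 : Fin 3) (1 : ℝ)) (hint : interior (SignCone w) = ∅)
    {f : EuclideanSpace ℝ (Fin 3)} (hf : f ∈ SignCone w) :
    ∃ a b : ℝ, a • EuclideanSpace.single (2 : Fin 3) (1 : ℝ) + b • e = f :=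
  Submodule.mem_span_pair.1 (signCone_subset_span_of_interior_empty he₃ he hind hint hf)

end Summit.NavierStokesRegularity.NavierStokesRegularity.Theorems.AxisTwistDoorSignConePlanarity

end
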